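/-
Copyright: the b2b-balaban T⁴-continuum CRUX team, row NE7b OWNER lineage `t4-ne7b-p1` (gen 146). Project licence.
-/
import Summits.QuantumFields.BalabanUV.T4Continuum.Spine.NE7b.SupHomogeneousVertexBoundsAbstract

/-!
# HOMOGENEOUS BOUNDS FOR CENTRED THREE-POINT FUNCTIONS WITH GENERAL BOUNDED VERTICES — GIBBS FORMAT (SCOPING-d17 §F, F9–F10: the
# order-5 interpolation inputs, second file).  (650)∕(654) treat the HESSIAN vertex `U″e_xe_y`.  The order-5 supported three-point terms
# of `M₅` ((610)) have a `U‴`-vertex (`𝟙[K3 ≠ 0]·C3k∕(ρρ)`) or TWO Hessian riders (`𝟙[Hk ≠ 0]𝟙[Hk ≠ 0]·C3h∕(ρρ)`).  THIS FILE proves the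
# homogeneous bounds ONCE for ARBITRARY vertex observables `P`, `Q : (ι → ℝ) → ℝ` bounded pointwise (`|P| ≤ β₁`, `|Q| ≤ β₂`) composed with
# the whitening map `w ↦ Aw + ψ`, against the gradient legs `U′e_v` under the whitened tilted law (fourth-moment letter
# `M₁ = 5κ₂⁴γ_op²∕(1−λγ_op)²`, (465)):
#   vertex FIRST ∕ MIDDLE: `≤ 2β·√M₁`;   two vertices in positions (1,2) ∕ (2,3): `≤ 4β₁β₂·√√M₁`
# — the `K3`-vertex takes `P = U‴(·)[e_x,e_y,e_z]`, `β = K3_{yzx}`; the riders `P = U″(·)[e_x,e_y]`, `β = Hk_{yx}`.  The tilted format and the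
# interpolated entries are the next files (row NE7b, node U5c; (465), (673) BY NAME; [folklore]).

Cell `pub-balaban`, sub-cell `t4`, spine estimate NE7b (`T4WeightBudget.RelWeightBound`; the cell's OWN estimate — NOT PRINTED in
[Bałaban 1983–89], NOT PROVED).  Crux-route work under `Spine/NE7b/` by the row OWNER (`t4-ne7b-p1` gen 146, file (674)) under FREEZE
(0)'s crux-prover clause; NOTHING of Bałaban's is named as a Lean object, valued or asserted; no `T4Continuum/Support` leaf typed; no
`def`, no notation; zero `sorry`.  Imports (BY NAME): the OWNER's (673) `…SupHomogeneousVertexBoundsAbstract` ((654), (650), (465) through it).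

WHAT IS PROVED ([folklore]): `abs_sub_integral_le`, **`gibbs_triple_vertex_first`**, **`gibbs_triple_vertex_middle`**,
**`gibbs_triple_two_vertices`**, **`gibbs_triple_two_vertices_23`**; toy.

HONEST (what this is NOT).  Gibbs-format moment inequalities; the four-point instances, the tilted format, the interpolated order-5 entries
`M₅′` and their weighted slot letters are the next files; scalar skeleton ((A3), NC-NE7b-α UNRULED); nothing of Bałaban's asserted.  BY-NAME
EFFECT ON THE WALL: NONE.  NE7b NOT PRINTED ∕ NOT PROVED; spine PROVED 0∕9; rung (B)+1 — the programme's measures remain FINITE-torus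
statements; NOT the mass gap, NOT Clay.  HONEST DEPENDENCY: continuum YM on T⁴ ⇐ BetaPertH ∧ nine spine estimates (0∕9 proved); BetaPertH ⇐
(D1) ∧ (D4) ∧ CAP+tail; G-an2-4 gates asym, D1 and NE2∕3∕4.
-/

set_option autoImplicit false
set_option maxSynthPendingDepth 2

noncomputable section

namespace Summit.QuantumFields.BalabanUV.T4Continuum.NE7b.SupHomogeneousVertexBounds

open MeasureTheory ProbabilityTheory Real Set Function Finset Matrix
open scoped BigOperators
open Literature.Probability.Distributions (matrixCLM)
open SupWhitenedFourthMoment (whitened_fourth_moment_gibbs whitened_fourth_power_integrable)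
open SupWhitenedMomentLetters (op_letter_nonneg whitened_exp_integrable)
open SupWhitenedCovarianceKernelLetter (whitened_integrable_lebesgue)
open SupEffectiveActionDerivative (mul_opBound_le_of_le)
open SupHomogeneousThreePoint (centred_triple_le_of_bounded_vertex)
open SupHomogeneousThreePointTwo (centred_triple_le_of_bounded_middle)
open SupHomogeneousVertexBoundsAbstract (centred_triple_le_of_two_bounded centred_triple_le_of_two_bounded_23)

/-! ## §1–§2. Gibbs format: general bounded vertices against gradient legs under the whitened tilted law -/

section Whitened

variable {ι κ : Type} [Fintype ι] [DecidableEq ι] [Fintype κ] [DecidableEq κ]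

variable {U : EuclideanSpace ℝ ι → ℝ} {U' : EuclideanSpace ℝ ι → EuclideanSpace ℝ ι →L[ℝ] ℝ}
  {U'' : EuclideanSpace ℝ ι → EuclideanSpace ℝ ι →L[ℝ] EuclideanSpace ℝ ι →L[ℝ] ℝ}
  {A : Matrix ι κ ℝ} {γop κ₀ κ₁ κ₂ a τ δ θp lam : ℝ}

/-- Centring a bounded observable under a probability law costs a factor `2`: `|P| ≤ β ⟹ |P(w) − ∫P| ≤ 2β`. [folklore] -/
theorem abs_sub_integral_le {Ω : Type*} [MeasurableSpace Ω] {ν : Measure Ω} [IsProbabilityMeasure ν] {P : Ω → ℝ} {β : ℝ}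
    (hP : ∀ ω, |P ω| ≤ β) (ω : Ω) : |P ω - ∫ ω', P ω' ∂ν| ≤ 2 * β := by
  have h2 : ‖∫ ω', P ω' ∂ν‖ ≤ β * ν.real Set.univ :=
    norm_integral_le_of_norm_le_const (Filter.Eventually.of_forall fun ω' => by rw [Real.norm_eq_abs]; exact hP ω')
  rw [probReal_univ, mul_one, Real.norm_eq_abs] at h2
  exact (abs_sub _ _).trans (by linarith [hP ω])

/-- **ONE BOUNDED VERTEX FIRST (Gibbs format)**: for any `P` with `|P| ≤ β` pointwise,
`|∫(P∘(A·+ψ) − E P)(F_z − EF_z)(F_t − EF_t)dν| ≤ 2β·√M₁`, `M₁ = 5κ₂⁴γ_op²∕(1−λγ_op)²`. [folklore] -/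
theorem gibbs_triple_vertex_first [Nonempty κ] (hΓop : (γop • (1 : Matrix ι ι ℝ) - A * Aᵀ).PosSemidef) (Y : Finset ι)
    (hUd : ∀ φ : EuclideanSpace ℝ ι, HasFDerivAt U (U' φ) φ) (hU'd : ∀ φ : EuclideanSpace ℝ ι, HasFDerivAt U' (U'' φ) φ) (hU''c : Continuous U'')
    (hκ₀ : 0 ≤ κ₀) (hκ₁ : 0 ≤ κ₁) (ha : 0 ≤ a) (hτ : 0 < τ) (hδ : 0 < δ) (hθ0 : 0 < θp) (hθ1 : θp < 1) (hκθ : (2 * κ₀ * (1 + τ) + 4 * δ) * γop ≤ θp)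
    (hstab : ∀ φ : EuclideanSpace ℝ ι, -(κ₀ * ∑ x ∈ Y, φ x ^ 2) ≤ U φ) (hU'b : ∀ φ : EuclideanSpace ℝ ι, ‖U' φ‖ ≤ κ₁ * (a + ∑ x ∈ Y, φ x ^ 2))
    (hU''b : ∀ φ : EuclideanSpace ℝ ι, ‖U'' φ‖ ≤ κ₂) (hlam : 0 ≤ lam)
    (hUsec : ∀ s : ℝ, 0 ≤ s → s ≤ 1 → ∀ a b : EuclideanSpace ℝ ι, U ((1 - s) • a + s • b) - lam / 2 * (s * (1 - s)) * ∑ i, (a i - b i) ^ 2 ≤ (1 -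
        s) * U a + s * U b)
    (hρ : lam * γop < 1) {P : EuclideanSpace ℝ ι → ℝ} {β : ℝ} (hβ : 0 ≤ β) (hP : ∀ φ, |P φ| ≤ β) (ψ : EuclideanSpace ℝ ι) (z t : ι) :
    |∫ w, (P (matrixCLM A (WithLp.toLp 2 w) + ψ) - ∫ w', P (matrixCLM A (WithLp.toLp 2 w') + ψ) ∂((volume : Measure (κ → ℝ)).tilted fun z =>
        -(1 / 2 * (z ⬝ᵥ z) + U (matrixCLM A (WithLp.toLp 2 z) + ψ)))) * (U' (matrixCLM A (WithLp.toLp 2 w) + ψ) (EuclideanSpace.single z (1 : ℝ)) -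
        ∫ w', U' (matrixCLM A (WithLp.toLp 2 w') + ψ) (EuclideanSpace.single z (1 : ℝ)) ∂((volume : Measure (κ → ℝ)).tilted fun z => -(1 / 2 * (z
        ⬝ᵥ z) + U (matrixCLM A (WithLp.toLp 2 z) + ψ)))) * (U' (matrixCLM A (WithLp.toLp 2 w) + ψ) (EuclideanSpace.single t (1 : ℝ)) - ∫ w', U'
        (matrixCLM A (WithLp.toLp 2 w') + ψ) (EuclideanSpace.single t (1 : ℝ)) ∂((volume : Measure (κ → ℝ)).tilted fun z => -(1 / 2 * (z ⬝ᵥ z) + U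
        (matrixCLM A (WithLp.toLp 2 z) + ψ)))) ∂((volume : Measure (κ → ℝ)).tilted fun z => -(1 / 2 * (z ⬝ᵥ z) + U (matrixCLM A (WithLp.toLp 2 z) +
        ψ)))| ≤
      2 * β * Real.sqrt (5 * (κ₂ ^ 4 * γop ^ 2) / (1 - lam * γop) ^ 2) := by
  haveI : Nonempty ι := ⟨z⟩
  have hUc : Continuous U := continuous_iff_continuousAt.2 fun φ => (hUd φ).continuousAt
  have hU'c : Continuous U' := continuous_iff_continuousAt.2 fun φ => (hU'd φ).continuousAt
  have hγop := op_letter_nonneg hΓop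
  have hκθ₀ : 2 * κ₀ * (1 + τ) * γop ≤ θp := mul_opBound_le_of_le (by positivity) (by linarith) hθ0.le hκθ
  have hI0 := whitened_exp_integrable hΓop Y hUc.measurable hκ₀ hτ hθ1 hκθ₀ hstab ψ
  have hV0 : Integrable (fun z : κ → ℝ => exp (-(1 / 2 * (z ⬝ᵥ z) + U (matrixCLM A (WithLp.toLp 2 z) + ψ)))) := by
    have h := whitened_integrable_lebesgue A ψ (k := fun _ => (1 : ℝ)) (by simpa only [mul_one] using hI0)
    simpa only [one_mul] using h
  haveI : IsProbabilityMeasure ((volume : Measure (κ → ℝ)).tilted fun z => -(1 / 2 * (z ⬝ᵥ z) + U (matrixCLM A (WithLp.toLp 2 z) + ψ))) :=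
    isProbabilityMeasure_tilted hV0
  have h4 := fun v => whitened_fourth_moment_gibbs hΓop Y hUd hU'd hU''c hκ₀ hκ₁ ha hτ hδ hθ0 hθ1 hκθ hstab hU'b hU''b hlam hUsec hρ ψ v
  have hI4 := fun v c => whitened_fourth_power_integrable hΓop Y hUd hU'd hκ₀ hκ₁ ha hτ hδ hθ0 hθ1 hκθ hstab hU'b ψ v c
  have hsh : Continuous fun w : κ → ℝ => matrixCLM A (WithLp.toLp 2 w) + ψ :=
    ((matrixCLM A).continuous.comp (PiLp.continuous_toLp 2 _)).add continuous_const
  have hFm : ∀ (v : ι) (c : ℝ), AEStronglyMeasurable (fun w : κ → ℝ => U' (matrixCLM A (WithLp.toLp 2 w) + ψ) (EuclideanSpace.single v (1 : ℝ))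
      - c) ((volume : Measure (κ → ℝ)).tilted fun z => -(1 / 2 * (z ⬝ᵥ z) + U (matrixCLM A (WithLp.toLp 2 z) + ψ))) :=
    fun v c => (((hU'c.comp hsh).clm_apply continuous_const).sub continuous_const).aestronglyMeasurable
  have hB := fun w : κ → ℝ => abs_sub_integral_le (ν := (volume : Measure (κ → ℝ)).tilted fun z => -(1 / 2 * (z ⬝ᵥ z) + U (matrixCLM A
    (WithLp.toLp 2 z) + ψ))) (P := fun w' => P (matrixCLM A (WithLp.toLp 2 w') + ψ)) (fun w' => hP _) w
  exact centred_triple_le_of_bounded_vertex hβ hB (hFm z _) (hFm t _) (hI4 z _) (hI4 t _) (h4 z) (h4 t)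

/-- **ONE BOUNDED VERTEX IN THE MIDDLE (Gibbs format)**: `|∫(F_x − EF_x)(P∘(A·+ψ) − E P)(F_t − EF_t)dν| ≤ 2β·√M₁`. [folklore] -/
theorem gibbs_triple_vertex_middle [Nonempty κ] (hΓop : (γop • (1 : Matrix ι ι ℝ) - A * Aᵀ).PosSemidef) (Y : Finset ι)
    (hUd : ∀ φ : EuclideanSpace ℝ ι, HasFDerivAt U (U' φ) φ) (hU'd : ∀ φ : EuclideanSpace ℝ ι, HasFDerivAt U' (U'' φ) φ) (hU''c : Continuous U'')
    (hκ₀ : 0 ≤ κ₀) (hκ₁ : 0 ≤ κ₁) (ha : 0 ≤ a) (hτ : 0 < τ) (hδ : 0 < δ) (hθ0 : 0 < θp) (hθ1 : θp < 1) (hκθ : (2 * κ₀ * (1 + τ) + 4 * δ) * γop ≤ θp)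
    (hstab : ∀ φ : EuclideanSpace ℝ ι, -(κ₀ * ∑ x ∈ Y, φ x ^ 2) ≤ U φ) (hU'b : ∀ φ : EuclideanSpace ℝ ι, ‖U' φ‖ ≤ κ₁ * (a + ∑ x ∈ Y, φ x ^ 2))
    (hU''b : ∀ φ : EuclideanSpace ℝ ι, ‖U'' φ‖ ≤ κ₂) (hlam : 0 ≤ lam)
    (hUsec : ∀ s : ℝ, 0 ≤ s → s ≤ 1 → ∀ a b : EuclideanSpace ℝ ι, U ((1 - s) • a + s • b) - lam / 2 * (s * (1 - s)) * ∑ i, (a i - b i) ^ 2 ≤ (1 -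
        s) * U a + s * U b)
    (hρ : lam * γop < 1) {P : EuclideanSpace ℝ ι → ℝ} {β : ℝ} (hβ : 0 ≤ β) (hP : ∀ φ, |P φ| ≤ β) (ψ : EuclideanSpace ℝ ι) (x t : ι) :
    |∫ w, (U' (matrixCLM A (WithLp.toLp 2 w) + ψ) (EuclideanSpace.single x (1 : ℝ)) - ∫ w', U' (matrixCLM A (WithLp.toLp 2 w') + ψ)
        (EuclideanSpace.single x (1 : ℝ)) ∂((volume : Measure (κ → ℝ)).tilted fun z => -(1 / 2 * (z ⬝ᵥ z) + U (matrixCLM A (WithLp.toLp 2 z) +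
        ψ)))) * (P (matrixCLM A (WithLp.toLp 2 w) + ψ) - ∫ w', P (matrixCLM A (WithLp.toLp 2 w') + ψ) ∂((volume : Measure (κ → ℝ)).tilted fun z
        => -(1 / 2 * (z ⬝ᵥ z) + U (matrixCLM A (WithLp.toLp 2 z) + ψ)))) * (U' (matrixCLM A (WithLp.toLp 2 w) + ψ) (EuclideanSpace.single t (1 :
        ℝ)) - ∫ w', U' (matrixCLM A (WithLp.toLp 2 w') + ψ) (EuclideanSpace.single t (1 : ℝ)) ∂((volume : Measure (κ → ℝ)).tilted fun z => -(1 / 2 *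
        (z ⬝ᵥ z) + U (matrixCLM A (WithLp.toLp 2 z) + ψ)))) ∂((volume : Measure (κ → ℝ)).tilted fun z => -(1 / 2 * (z ⬝ᵥ z) + U (matrixCLM A
        (WithLp.toLp 2 z) + ψ)))| ≤
      2 * β * Real.sqrt (5 * (κ₂ ^ 4 * γop ^ 2) / (1 - lam * γop) ^ 2) := by
  haveI : Nonempty ι := ⟨x⟩
  have hUc : Continuous U := continuous_iff_continuousAt.2 fun φ => (hUd φ).continuousAt
  have hU'c : Continuous U' := continuous_iff_continuousAt.2 fun φ => (hU'd φ).continuousAt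
  have hγop := op_letter_nonneg hΓop
  have hκθ₀ : 2 * κ₀ * (1 + τ) * γop ≤ θp := mul_opBound_le_of_le (by positivity) (by linarith) hθ0.le hκθ
  have hI0 := whitened_exp_integrable hΓop Y hUc.measurable hκ₀ hτ hθ1 hκθ₀ hstab ψ
  have hV0 : Integrable (fun z : κ → ℝ => exp (-(1 / 2 * (z ⬝ᵥ z) + U (matrixCLM A (WithLp.toLp 2 z) + ψ)))) := by
    have h := whitened_integrable_lebesgue A ψ (k := fun _ => (1 : ℝ)) (by simpa only [mul_one] using hI0)
    simpa only [one_mul] using h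
  haveI : IsProbabilityMeasure ((volume : Measure (κ → ℝ)).tilted fun z => -(1 / 2 * (z ⬝ᵥ z) + U (matrixCLM A (WithLp.toLp 2 z) + ψ))) :=
    isProbabilityMeasure_tilted hV0
  have h4 := fun v => whitened_fourth_moment_gibbs hΓop Y hUd hU'd hU''c hκ₀ hκ₁ ha hτ hδ hθ0 hθ1 hκθ hstab hU'b hU''b hlam hUsec hρ ψ v
  have hI4 := fun v c => whitened_fourth_power_integrable hΓop Y hUd hU'd hκ₀ hκ₁ ha hτ hδ hθ0 hθ1 hκθ hstab hU'b ψ v c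
  have hsh : Continuous fun w : κ → ℝ => matrixCLM A (WithLp.toLp 2 w) + ψ :=
    ((matrixCLM A).continuous.comp (PiLp.continuous_toLp 2 _)).add continuous_const
  have hFm : ∀ (v : ι) (c : ℝ), AEStronglyMeasurable (fun w : κ → ℝ => U' (matrixCLM A (WithLp.toLp 2 w) + ψ) (EuclideanSpace.single v (1 : ℝ))
      - c) ((volume : Measure (κ → ℝ)).tilted fun z => -(1 / 2 * (z ⬝ᵥ z) + U (matrixCLM A (WithLp.toLp 2 z) + ψ))) :=
    fun v c => (((hU'c.comp hsh).clm_apply continuous_const).sub continuous_const).aestronglyMeasurable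
  have hB := fun w : κ → ℝ => abs_sub_integral_le (ν := (volume : Measure (κ → ℝ)).tilted fun z => -(1 / 2 * (z ⬝ᵥ z) + U (matrixCLM A
    (WithLp.toLp 2 z) + ψ))) (P := fun w' => P (matrixCLM A (WithLp.toLp 2 w') + ψ)) (fun w' => hP _) w
  exact centred_triple_le_of_bounded_middle hβ hB (hFm x _) (hFm t _) (hI4 x _) (hI4 t _) (h4 x) (h4 t)

/-- **TWO BOUNDED VERTICES IN POSITIONS 1, 2 (Gibbs format)**: `|P| ≤ β₁`, `|Q| ≤ β₂` pointwise give
`|∫(P∘ − EP)(Q∘ − EQ)(F_s − EF_s)dν| ≤ 4β₁β₂·√√M₁`. [folklore] -/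
theorem gibbs_triple_two_vertices [Nonempty κ] (hΓop : (γop • (1 : Matrix ι ι ℝ) - A * Aᵀ).PosSemidef) (Y : Finset ι)
    (hUd : ∀ φ : EuclideanSpace ℝ ι, HasFDerivAt U (U' φ) φ) (hU'd : ∀ φ : EuclideanSpace ℝ ι, HasFDerivAt U' (U'' φ) φ) (hU''c : Continuous U'')
    (hκ₀ : 0 ≤ κ₀) (hκ₁ : 0 ≤ κ₁) (ha : 0 ≤ a) (hτ : 0 < τ) (hδ : 0 < δ) (hθ0 : 0 < θp) (hθ1 : θp < 1) (hκθ : (2 * κ₀ * (1 + τ) + 4 * δ) * γop ≤ θp)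
    (hstab : ∀ φ : EuclideanSpace ℝ ι, -(κ₀ * ∑ x ∈ Y, φ x ^ 2) ≤ U φ) (hU'b : ∀ φ : EuclideanSpace ℝ ι, ‖U' φ‖ ≤ κ₁ * (a + ∑ x ∈ Y, φ x ^ 2))
    (hU''b : ∀ φ : EuclideanSpace ℝ ι, ‖U'' φ‖ ≤ κ₂) (hlam : 0 ≤ lam)
    (hUsec : ∀ s : ℝ, 0 ≤ s → s ≤ 1 → ∀ a b : EuclideanSpace ℝ ι, U ((1 - s) • a + s • b) - lam / 2 * (s * (1 - s)) * ∑ i, (a i - b i) ^ 2 ≤ (1 -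
        s) * U a + s * U b)
    (hρ : lam * γop < 1) {P Q : EuclideanSpace ℝ ι → ℝ} {β₁ β₂ : ℝ} (hβ₁ : 0 ≤ β₁) (hβ₂ : 0 ≤ β₂) (hP : ∀ φ, |P φ| ≤ β₁) (hQ : ∀ φ, |Q φ| ≤ β₂)
    (ψ : EuclideanSpace ℝ ι) (s : ι) :
    |∫ w, (P (matrixCLM A (WithLp.toLp 2 w) + ψ) - ∫ w', P (matrixCLM A (WithLp.toLp 2 w') + ψ) ∂((volume : Measure (κ → ℝ)).tilted fun z =>
        -(1 / 2 * (z ⬝ᵥ z) + U (matrixCLM A (WithLp.toLp 2 z) + ψ)))) * (Q (matrixCLM A (WithLp.toLp 2 w) + ψ) - ∫ w', Q (matrixCLM A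
        (WithLp.toLp 2 w') + ψ) ∂((volume : Measure (κ → ℝ)).tilted fun z => -(1 / 2 * (z ⬝ᵥ z) + U (matrixCLM A (WithLp.toLp 2 z) + ψ)))) * (U'
        (matrixCLM A (WithLp.toLp 2 w) + ψ) (EuclideanSpace.single s (1 : ℝ)) - ∫ w', U' (matrixCLM A (WithLp.toLp 2 w') + ψ) (EuclideanSpace.single
        s (1 : ℝ)) ∂((volume : Measure (κ → ℝ)).tilted fun z => -(1 / 2 * (z ⬝ᵥ z) + U (matrixCLM A (WithLp.toLp 2 z) + ψ))))
        ∂((volume : Measure (κ → ℝ)).tilted fun z => -(1 / 2 * (z ⬝ᵥ z) + U (matrixCLM A (WithLp.toLp 2 z) + ψ)))| ≤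
      4 * β₁ * β₂ * Real.sqrt (Real.sqrt (5 * (κ₂ ^ 4 * γop ^ 2) / (1 - lam * γop) ^ 2)) := by
  haveI : Nonempty ι := ⟨s⟩
  have hUc : Continuous U := continuous_iff_continuousAt.2 fun φ => (hUd φ).continuousAt
  have hU'c : Continuous U' := continuous_iff_continuousAt.2 fun φ => (hU'd φ).continuousAt
  have hγop := op_letter_nonneg hΓop
  have hκθ₀ : 2 * κ₀ * (1 + τ) * γop ≤ θp := mul_opBound_le_of_le (by positivity) (by linarith) hθ0.le hκθ
  have hI0 := whitened_exp_integrable hΓop Y hUc.measurable hκ₀ hτ hθ1 hκθ₀ hstab ψ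
  have hV0 : Integrable (fun z : κ → ℝ => exp (-(1 / 2 * (z ⬝ᵥ z) + U (matrixCLM A (WithLp.toLp 2 z) + ψ)))) := by
    have h := whitened_integrable_lebesgue A ψ (k := fun _ => (1 : ℝ)) (by simpa only [mul_one] using hI0)
    simpa only [one_mul] using h
  haveI : IsProbabilityMeasure ((volume : Measure (κ → ℝ)).tilted fun z => -(1 / 2 * (z ⬝ᵥ z) + U (matrixCLM A (WithLp.toLp 2 z) + ψ))) :=
    isProbabilityMeasure_tilted hV0
  have h4 := fun v => whitened_fourth_moment_gibbs hΓop Y hUd hU'd hU''c hκ₀ hκ₁ ha hτ hδ hθ0 hθ1 hκθ hstab hU'b hU''b hlam hUsec hρ ψ v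
  have hI4 := fun v c => whitened_fourth_power_integrable hΓop Y hUd hU'd hκ₀ hκ₁ ha hτ hδ hθ0 hθ1 hκθ hstab hU'b ψ v c
  have hsh : Continuous fun w : κ → ℝ => matrixCLM A (WithLp.toLp 2 w) + ψ :=
    ((matrixCLM A).continuous.comp (PiLp.continuous_toLp 2 _)).add continuous_const
  have hFm : ∀ (v : ι) (c : ℝ), AEStronglyMeasurable (fun w : κ → ℝ => U' (matrixCLM A (WithLp.toLp 2 w) + ψ) (EuclideanSpace.single v (1 : ℝ))
      - c) ((volume : Measure (κ → ℝ)).tilted fun z => -(1 / 2 * (z ⬝ᵥ z) + U (matrixCLM A (WithLp.toLp 2 z) + ψ))) :=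
    fun v c => (((hU'c.comp hsh).clm_apply continuous_const).sub continuous_const).aestronglyMeasurable
  have hB₁ := fun w : κ → ℝ => abs_sub_integral_le (ν := (volume : Measure (κ → ℝ)).tilted fun z => -(1 / 2 * (z ⬝ᵥ z) + U (matrixCLM A
    (WithLp.toLp 2 z) + ψ))) (P := fun w' => P (matrixCLM A (WithLp.toLp 2 w') + ψ)) (fun w' => hP _) w
  have hB₂ := fun w : κ → ℝ => abs_sub_integral_le (ν := (volume : Measure (κ → ℝ)).tilted fun z => -(1 / 2 * (z ⬝ᵥ z) + U (matrixCLM A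
    (WithLp.toLp 2 z) + ψ))) (P := fun w' => Q (matrixCLM A (WithLp.toLp 2 w') + ψ)) (fun w' => hQ _) w
  exact centred_triple_le_of_two_bounded hβ₁ hβ₂ hB₁ hB₂ (hFm s _) (hI4 s _) (h4 s)

/-- **TWO BOUNDED VERTICES IN POSITIONS 2, 3 (Gibbs format)**: `|∫(F_x − EF_x)(P∘ − EP)(Q∘ − EQ)dν| ≤ 4β₁β₂·√√M₁`. [folklore] -/
theorem gibbs_triple_two_vertices_23 [Nonempty κ] (hΓop : (γop • (1 : Matrix ι ι ℝ) - A * Aᵀ).PosSemidef) (Y : Finset ι)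
    (hUd : ∀ φ : EuclideanSpace ℝ ι, HasFDerivAt U (U' φ) φ) (hU'd : ∀ φ : EuclideanSpace ℝ ι, HasFDerivAt U' (U'' φ) φ) (hU''c : Continuous U'')
    (hκ₀ : 0 ≤ κ₀) (hκ₁ : 0 ≤ κ₁) (ha : 0 ≤ a) (hτ : 0 < τ) (hδ : 0 < δ) (hθ0 : 0 < θp) (hθ1 : θp < 1) (hκθ : (2 * κ₀ * (1 + τ) + 4 * δ) * γop ≤ θp)
    (hstab : ∀ φ : EuclideanSpace ℝ ι, -(κ₀ * ∑ x ∈ Y, φ x ^ 2) ≤ U φ) (hU'b : ∀ φ : EuclideanSpace ℝ ι, ‖U' φ‖ ≤ κ₁ * (a + ∑ x ∈ Y, φ x ^ 2))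
    (hU''b : ∀ φ : EuclideanSpace ℝ ι, ‖U'' φ‖ ≤ κ₂) (hlam : 0 ≤ lam)
    (hUsec : ∀ s : ℝ, 0 ≤ s → s ≤ 1 → ∀ a b : EuclideanSpace ℝ ι, U ((1 - s) • a + s • b) - lam / 2 * (s * (1 - s)) * ∑ i, (a i - b i) ^ 2 ≤ (1 -
        s) * U a + s * U b)
    (hρ : lam * γop < 1) {P Q : EuclideanSpace ℝ ι → ℝ} {β₁ β₂ : ℝ} (hβ₁ : 0 ≤ β₁) (hβ₂ : 0 ≤ β₂) (hP : ∀ φ, |P φ| ≤ β₁) (hQ : ∀ φ, |Q φ| ≤ β₂)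
    (ψ : EuclideanSpace ℝ ι) (x : ι) :
    |∫ w, (U' (matrixCLM A (WithLp.toLp 2 w) + ψ) (EuclideanSpace.single x (1 : ℝ)) - ∫ w', U' (matrixCLM A (WithLp.toLp 2 w') + ψ)
        (EuclideanSpace.single x (1 : ℝ)) ∂((volume : Measure (κ → ℝ)).tilted fun z => -(1 / 2 * (z ⬝ᵥ z) + U (matrixCLM A (WithLp.toLp 2 z) +
        ψ)))) * (P (matrixCLM A (WithLp.toLp 2 w) + ψ) - ∫ w', P (matrixCLM A (WithLp.toLp 2 w') + ψ) ∂((volume : Measure (κ → ℝ)).tilted fun z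
        => -(1 / 2 * (z ⬝ᵥ z) + U (matrixCLM A (WithLp.toLp 2 z) + ψ)))) * (Q (matrixCLM A (WithLp.toLp 2 w) + ψ) - ∫ w', Q (matrixCLM A
        (WithLp.toLp 2 w') + ψ) ∂((volume : Measure (κ → ℝ)).tilted fun z => -(1 / 2 * (z ⬝ᵥ z) + U (matrixCLM A (WithLp.toLp 2 z) + ψ))))
        ∂((volume : Measure (κ → ℝ)).tilted fun z => -(1 / 2 * (z ⬝ᵥ z) + U (matrixCLM A (WithLp.toLp 2 z) + ψ)))| ≤
      4 * β₁ * β₂ * Real.sqrt (Real.sqrt (5 * (κ₂ ^ 4 * γop ^ 2) / (1 - lam * γop) ^ 2)) := by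
  haveI : Nonempty ι := ⟨x⟩
  have hUc : Continuous U := continuous_iff_continuousAt.2 fun φ => (hUd φ).continuousAt
  have hU'c : Continuous U' := continuous_iff_continuousAt.2 fun φ => (hU'd φ).continuousAt
  have hγop := op_letter_nonneg hΓop
  have hκθ₀ : 2 * κ₀ * (1 + τ) * γop ≤ θp := mul_opBound_le_of_le (by positivity) (by linarith) hθ0.le hκθ
  have hI0 := whitened_exp_integrable hΓop Y hUc.measurable hκ₀ hτ hθ1 hκθ₀ hstab ψ
  have hV0 : Integrable (fun z : κ → ℝ => exp (-(1 / 2 * (z ⬝ᵥ z) + U (matrixCLM A (WithLp.toLp 2 z) + ψ)))) := by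
    have h := whitened_integrable_lebesgue A ψ (k := fun _ => (1 : ℝ)) (by simpa only [mul_one] using hI0)
    simpa only [one_mul] using h
  haveI : IsProbabilityMeasure ((volume : Measure (κ → ℝ)).tilted fun z => -(1 / 2 * (z ⬝ᵥ z) + U (matrixCLM A (WithLp.toLp 2 z) + ψ))) :=
    isProbabilityMeasure_tilted hV0
  have h4 := fun v => whitened_fourth_moment_gibbs hΓop Y hUd hU'd hU''c hκ₀ hκ₁ ha hτ hδ hθ0 hθ1 hκθ hstab hU'b hU''b hlam hUsec hρ ψ v
  have hI4 := fun v c => whitened_fourth_power_integrable hΓop Y hUd hU'd hκ₀ hκ₁ ha hτ hδ hθ0 hθ1 hκθ hstab hU'b ψ v c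
  have hsh : Continuous fun w : κ → ℝ => matrixCLM A (WithLp.toLp 2 w) + ψ :=
    ((matrixCLM A).continuous.comp (PiLp.continuous_toLp 2 _)).add continuous_const
  have hFm : ∀ (v : ι) (c : ℝ), AEStronglyMeasurable (fun w : κ → ℝ => U' (matrixCLM A (WithLp.toLp 2 w) + ψ) (EuclideanSpace.single v (1 : ℝ))
      - c) ((volume : Measure (κ → ℝ)).tilted fun z => -(1 / 2 * (z ⬝ᵥ z) + U (matrixCLM A (WithLp.toLp 2 z) + ψ))) :=
    fun v c => (((hU'c.comp hsh).clm_apply continuous_const).sub continuous_const).aestronglyMeasurable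
  have hB₁ := fun w : κ → ℝ => abs_sub_integral_le (ν := (volume : Measure (κ → ℝ)).tilted fun z => -(1 / 2 * (z ⬝ᵥ z) + U (matrixCLM A
    (WithLp.toLp 2 z) + ψ))) (P := fun w' => P (matrixCLM A (WithLp.toLp 2 w') + ψ)) (fun w' => hP _) w
  have hB₂ := fun w : κ → ℝ => abs_sub_integral_le (ν := (volume : Measure (κ → ℝ)).tilted fun z => -(1 / 2 * (z ⬝ᵥ z) + U (matrixCLM A
    (WithLp.toLp 2 z) + ψ))) (P := fun w' => Q (matrixCLM A (WithLp.toLp 2 w') + ψ)) (fun w' => hQ _) w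
  exact centred_triple_le_of_two_bounded_23 hβ₁ hβ₂ hB₁ hB₂ (hFm x _) (hI4 x _) (h4 x)

end Whitened

/-! ## §3. Toy -/

/-- Toy (the centring factor): `|P| ≤ β` on a two-point space with the uniform law gives `|P(w) − mean| ≤ 2β` — e.g. `P = ±1`, `β = 1`:
`|1 − 0| ≤ 2`. -/
example : |(1 : ℝ) - 0| ≤ 2 * 1 := by norm_num

end Summit.QuantumFields.BalabanUV.T4Continuum.NE7b.SupHomogeneousVertexBounds

end
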